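import Summits.Ventures.PercRepro.RankLevelSetLevelFiveSharpT
import Summits.Ventures.PercRepro.S2SharpCoreX
import Summits.Ventures.PercRepro.S2SharpCoreXMid
import Summits.Ventures.PercRepro.S2MidFlatsEight
import Summits.Ventures.PercRepro.S2CellsP22X
import Summits.Ventures.PercRepro.S2TailP22X
import Summits.Ventures.PercRepro.S2CellsP22XM
import Summits.Ventures.PercRepro.S2CellsP23X
import Summits.Ventures.PercRepro.S2TailP23X
import Summits.Ventures.PercRepro.S2CellsP24X
import Summits.Ventures.PercRepro.S2TailP24X
import Summits.Ventures.PercRepro.S2CoreTwentyFour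
import Summits.Ventures.PercRepro.S2CoreTwentyThree
import Summits.Ventures.PercRepro.S2CoreTwentyTwo

/-!
# PercRepro — THEOREM C₅ AT `23`: p1's T⁺⁺⁺ / T4⁺ ON THE SET-INDEXED COUNT (p7, gen 3; sub-claim S2)

THEOREM C₅ AT `26` three steps further. With p1's LEMMA T⁺⁺⁺ (`s₃ ≤ (d² − 3d + 6)/2`, S1TrianglePlusSharp) and
LEMMA T4⁺ (`s₄ ≤ fourCircuitBound d`, S1CoreFourCircuitSum) in the set-indexed count (S2SetCountQ) every cell
`(p, d)` with `22 ≤ p ≤ 24`, `6 ≤ d ≤ 25` (and `(22, 26)`) closes with the free slack — except `(22, 8)`, which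
closes with the mid class explicit (S2MidFlatsEight, S2SetCountMid); the coranks `≥ 26` at `p = 24, 23` and `≥ 27`
at `p = 22` close by the sum key (S2CoreTwentyFour / -Three / -Two). Hence:

* **`c025_core_five_twentytwo`** / **`_twentythree`** / **`_twentyfour_x`** — the `e`-free core at level `5` at these
  ranks, every corank `≥ 6` below the sum key's range;
* **`c025_five_of_four_sharp_x_from`** — for `P ≥ 22`, level `4` for all `p ≥ P` implies level `5` for all `p ≥ P + 1`;
* **`c025_five_large_sharp23`** — UNCONDITIONAL over the landed tree: C-025 at level `5` for every `p ≥ 23` (level `4`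
  from S1's `c025_four_seventeen`); `c025_five_large_sharp23'` is the `C025` spelling.
Axioms: standard.
-/

open scoped Matroid

namespace PercRepro

namespace S2

/-- **The `p = 22` cells, dispatched**: for every corank `6 ≤ d ≤ 25` some slack `m ≤ 1024` with
`1024·U′(22, d) ≤ (1024 − m)·2^(d−5)·C(27, 5)` and `1024·T′(22 + d, d) ≤ m·2^(22+d)`. -/
theorem cellsP22X (d : ℕ) (hd6 : 6 ≤ d) (hd25 : d ≤ 26) (hd8 : d ≠ 8) :
    ∃ m : ℕ, m ≤ 1024 ∧
      (1024 * (((22 + d).choose 5 : ℚ) +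
      (∑ j ∈ Finset.range (d - 5), (Nat.choose (min 13 ((d + 6) / 2 + 1 - 2)) j : ℚ) / (((j + 1) + 3 * (j + 1).choose 2 : ℕ) : ℚ)) *
        ((((d * d + 6 - 3 * d) / 2) * (22 + d - 3).choose 3 + S1.fourCircuitBound d * (22 + d - 4).choose 2 + (d + 4).choose 5 * (22 + d - 5) + (d + 5).choose 6 : ℕ) : ℚ) +
      ((∑ j ∈ Finset.range (d - 5), (Nat.choose (min 19 (5 + d) - 6) j : ℚ) / (((j + 1) + 3 * (j + 1).choose 2 : ℕ) : ℚ)) -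
        (∑ j ∈ Finset.range (d - 5), (Nat.choose (min 13 ((d + 6) / 2 + 1 - 2)) j : ℚ) / (((j + 1) + 3 * (j + 1).choose 2 : ℕ) : ℚ))) *
        ((min 19 (5 + d)).choose 6 : ℚ)) ≤
        ((1024 - m : ℕ) : ℚ) * 2 ^ (d - 5) * ((22 + 5).choose 5 : ℚ)) ∧
      (1024 * ((((22 + d).choose 4 * 2 ^ 6 + (22 + d).choose 3 * 2 ^ 3 + (22 + d).choose 2 * 2 + (22 + d) + 1 : ℕ) : ℚ) +
      (((22 + d).choose 5 : ℚ) + (∑ j ∈ Finset.range (d), (Nat.choose (min 13 ((d + 6) / 2 + 1 - 2)) j : ℚ) / (((j + 1) + 3 * (j + 1).choose 2 : ℕ) : ℚ)) * ((((d * d + 6 - 3 * d) / 2) * (22 + d - 3).choose 3 + S1.fourCircuitBound d * (22 + d - 4).choose 2 + (d + 4).choose 5 * (22 + d - 5) + (d + 5).choose 6 : ℕ) : ℚ) +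
        ((∑ j ∈ Finset.range (d), (Nat.choose (min 19 (5 + d) - 6) j : ℚ) / (((j + 1) + 3 * (j + 1).choose 2 : ℕ) : ℚ)) - (∑ j ∈ Finset.range (d), (Nat.choose (min 13 ((d + 6) / 2 + 1 - 2)) j : ℚ) / (((j + 1) + 3 * (j + 1).choose 2 : ℕ) : ℚ))) * ((min 19 (5 + d)).choose 6 : ℚ)) +
      ((∑ j ∈ Finset.range (d + 1), (22 + d).choose j : ℕ) : ℚ)) ≤ (m : ℚ) * 2 ^ (22 + d)) := by
  interval_cases d
  · exact ⟨9, by norm_num, cellP22X_poly_6, cellP22X_tail_6⟩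
  · exact ⟨8, by norm_num, cellP22X_poly_7, cellP22X_tail_7⟩
  · exact absurd rfl hd8
  · exact ⟨17, by norm_num, cellP22X_poly_9, cellP22X_tail_9⟩
  · exact ⟨27, by norm_num, cellP22X_poly_10, cellP22X_tail_10⟩
  · exact ⟨42, by norm_num, cellP22X_poly_11, cellP22X_tail_11⟩
  · exact ⟨63, by norm_num, cellP22X_poly_12, cellP22X_tail_12⟩
  · exact ⟨91, by norm_num, cellP22X_poly_13, cellP22X_tail_13⟩
  · exact ⟨125, by norm_num, cellP22X_poly_14, cellP22X_tail_14⟩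
  · exact ⟨167, by norm_num, cellP22X_poly_15, cellP22X_tail_15⟩
  · exact ⟨215, by norm_num, cellP22X_poly_16, cellP22X_tail_16⟩
  · exact ⟨268, by norm_num, cellP22X_poly_17, cellP22X_tail_17⟩
  · exact ⟨326, by norm_num, cellP22X_poly_18, cellP22X_tail_18⟩
  · exact ⟨387, by norm_num, cellP22X_poly_19, cellP22X_tail_19⟩
  · exact ⟨450, by norm_num, cellP22X_poly_20, cellP22X_tail_20⟩
  · exact ⟨513, by norm_num, cellP22X_poly_21, cellP22X_tail_21⟩
  · exact ⟨574, by norm_num, cellP22X_poly_22, cellP22X_tail_22⟩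
  · exact ⟨632, by norm_num, cellP22X_poly_23, cellP22X_tail_23⟩
  · exact ⟨687, by norm_num, cellP22X_poly_24, cellP22X_tail_24⟩
  · exact ⟨738, by norm_num, cellP22X_poly_25, cellP22X_tail_25⟩
  · exact ⟨783, by norm_num, cellP22X_poly_26, cellP22X_tail_26⟩

/-- **The `p = 23` cells, dispatched**: for every corank `6 ≤ d ≤ 25` some slack `m ≤ 1024` with
`1024·U′(23, d) ≤ (1024 − m)·2^(d−5)·C(28, 5)` and `1024·T′(23 + d, d) ≤ m·2^(23+d)`. -/
theorem cellsP23X (d : ℕ) (hd6 : 6 ≤ d) (hd25 : d ≤ 25) :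
    ∃ m : ℕ, m ≤ 1024 ∧
      (1024 * (((23 + d).choose 5 : ℚ) +
      (∑ j ∈ Finset.range (d - 5), (Nat.choose (min 13 ((d + 6) / 2 + 1 - 2)) j : ℚ) / (((j + 1) + 3 * (j + 1).choose 2 : ℕ) : ℚ)) *
        ((((d * d + 6 - 3 * d) / 2) * (23 + d - 3).choose 3 + S1.fourCircuitBound d * (23 + d - 4).choose 2 + (d + 4).choose 5 * (23 + d - 5) + (d + 5).choose 6 : ℕ) : ℚ) +
      ((∑ j ∈ Finset.range (d - 5), (Nat.choose (min 19 (5 + d) - 6) j : ℚ) / (((j + 1) + 3 * (j + 1).choose 2 : ℕ) : ℚ)) -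
        (∑ j ∈ Finset.range (d - 5), (Nat.choose (min 13 ((d + 6) / 2 + 1 - 2)) j : ℚ) / (((j + 1) + 3 * (j + 1).choose 2 : ℕ) : ℚ))) *
        ((min 19 (5 + d)).choose 6 : ℚ)) ≤
        ((1024 - m : ℕ) : ℚ) * 2 ^ (d - 5) * ((23 + 5).choose 5 : ℚ)) ∧
      (1024 * ((((23 + d).choose 4 * 2 ^ 6 + (23 + d).choose 3 * 2 ^ 3 + (23 + d).choose 2 * 2 + (23 + d) + 1 : ℕ) : ℚ) +
      (((23 + d).choose 5 : ℚ) + (∑ j ∈ Finset.range (d), (Nat.choose (min 13 ((d + 6) / 2 + 1 - 2)) j : ℚ) / (((j + 1) + 3 * (j + 1).choose 2 : ℕ) : ℚ)) * ((((d * d + 6 - 3 * d) / 2) * (23 + d - 3).choose 3 + S1.fourCircuitBound d * (23 + d - 4).choose 2 + (d + 4).choose 5 * (23 + d - 5) + (d + 5).choose 6 : ℕ) : ℚ) +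
        ((∑ j ∈ Finset.range (d), (Nat.choose (min 19 (5 + d) - 6) j : ℚ) / (((j + 1) + 3 * (j + 1).choose 2 : ℕ) : ℚ)) - (∑ j ∈ Finset.range (d), (Nat.choose (min 13 ((d + 6) / 2 + 1 - 2)) j : ℚ) / (((j + 1) + 3 * (j + 1).choose 2 : ℕ) : ℚ))) * ((min 19 (5 + d)).choose 6 : ℚ)) +
      ((∑ j ∈ Finset.range (d + 1), (23 + d).choose j : ℕ) : ℚ)) ≤ (m : ℚ) * 2 ^ (23 + d)) := by
  interval_cases d
  · exact ⟨5, by norm_num, cellP23X_poly_6, cellP23X_tail_6⟩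
  · exact ⟨5, by norm_num, cellP23X_poly_7, cellP23X_tail_7⟩
  · exact ⟨7, by norm_num, cellP23X_poly_8, cellP23X_tail_8⟩
  · exact ⟨12, by norm_num, cellP23X_poly_9, cellP23X_tail_9⟩
  · exact ⟨19, by norm_num, cellP23X_poly_10, cellP23X_tail_10⟩
  · exact ⟨30, by norm_num, cellP23X_poly_11, cellP23X_tail_11⟩
  · exact ⟨47, by norm_num, cellP23X_poly_12, cellP23X_tail_12⟩
  · exact ⟨69, by norm_num, cellP23X_poly_13, cellP23X_tail_13⟩
  · exact ⟨97, by norm_num, cellP23X_poly_14, cellP23X_tail_14⟩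
  · exact ⟨132, by norm_num, cellP23X_poly_15, cellP23X_tail_15⟩
  · exact ⟨173, by norm_num, cellP23X_poly_16, cellP23X_tail_16⟩
  · exact ⟨221, by norm_num, cellP23X_poly_17, cellP23X_tail_17⟩
  · exact ⟨273, by norm_num, cellP23X_poly_18, cellP23X_tail_18⟩
  · exact ⟨330, by norm_num, cellP23X_poly_19, cellP23X_tail_19⟩
  · exact ⟨390, by norm_num, cellP23X_poly_20, cellP23X_tail_20⟩
  · exact ⟨451, by norm_num, cellP23X_poly_21, cellP23X_tail_21⟩
  · exact ⟨513, by norm_num, cellP23X_poly_22, cellP23X_tail_22⟩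
  · exact ⟨572, by norm_num, cellP23X_poly_23, cellP23X_tail_23⟩
  · exact ⟨630, by norm_num, cellP23X_poly_24, cellP23X_tail_24⟩
  · exact ⟨684, by norm_num, cellP23X_poly_25, cellP23X_tail_25⟩

/-- **The `p = 24` cells, dispatched**: for every corank `6 ≤ d ≤ 25` some slack `m ≤ 1024` with
`1024·U′(24, d) ≤ (1024 − m)·2^(d−5)·C(29, 5)` and `1024·T′(24 + d, d) ≤ m·2^(24+d)`. -/
theorem cellsP24X (d : ℕ) (hd6 : 6 ≤ d) (hd25 : d ≤ 25) :
    ∃ m : ℕ, m ≤ 1024 ∧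
      (1024 * (((24 + d).choose 5 : ℚ) +
      (∑ j ∈ Finset.range (d - 5), (Nat.choose (min 13 ((d + 6) / 2 + 1 - 2)) j : ℚ) / (((j + 1) + 3 * (j + 1).choose 2 : ℕ) : ℚ)) *
        ((((d * d + 6 - 3 * d) / 2) * (24 + d - 3).choose 3 + S1.fourCircuitBound d * (24 + d - 4).choose 2 + (d + 4).choose 5 * (24 + d - 5) + (d + 5).choose 6 : ℕ) : ℚ) +
      ((∑ j ∈ Finset.range (d - 5), (Nat.choose (min 19 (5 + d) - 6) j : ℚ) / (((j + 1) + 3 * (j + 1).choose 2 : ℕ) : ℚ)) -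
        (∑ j ∈ Finset.range (d - 5), (Nat.choose (min 13 ((d + 6) / 2 + 1 - 2)) j : ℚ) / (((j + 1) + 3 * (j + 1).choose 2 : ℕ) : ℚ))) *
        ((min 19 (5 + d)).choose 6 : ℚ)) ≤
        ((1024 - m : ℕ) : ℚ) * 2 ^ (d - 5) * ((24 + 5).choose 5 : ℚ)) ∧
      (1024 * ((((24 + d).choose 4 * 2 ^ 6 + (24 + d).choose 3 * 2 ^ 3 + (24 + d).choose 2 * 2 + (24 + d) + 1 : ℕ) : ℚ) +
      (((24 + d).choose 5 : ℚ) + (∑ j ∈ Finset.range (d), (Nat.choose (min 13 ((d + 6) / 2 + 1 - 2)) j : ℚ) / (((j + 1) + 3 * (j + 1).choose 2 : ℕ) : ℚ)) * ((((d * d + 6 - 3 * d) / 2) * (24 + d - 3).choose 3 + S1.fourCircuitBound d * (24 + d - 4).choose 2 + (d + 4).choose 5 * (24 + d - 5) + (d + 5).choose 6 : ℕ) : ℚ) +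
        ((∑ j ∈ Finset.range (d), (Nat.choose (min 19 (5 + d) - 6) j : ℚ) / (((j + 1) + 3 * (j + 1).choose 2 : ℕ) : ℚ)) - (∑ j ∈ Finset.range (d), (Nat.choose (min 13 ((d + 6) / 2 + 1 - 2)) j : ℚ) / (((j + 1) + 3 * (j + 1).choose 2 : ℕ) : ℚ))) * ((min 19 (5 + d)).choose 6 : ℚ)) +
      ((∑ j ∈ Finset.range (d + 1), (24 + d).choose j : ℕ) : ℚ)) ≤ (m : ℚ) * 2 ^ (24 + d)) := by
  interval_cases d
  · exact ⟨3, by norm_num, cellP24X_poly_6, cellP24X_tail_6⟩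
  · exact ⟨3, by norm_num, cellP24X_poly_7, cellP24X_tail_7⟩
  · exact ⟨5, by norm_num, cellP24X_poly_8, cellP24X_tail_8⟩
  · exact ⟨8, by norm_num, cellP24X_poly_9, cellP24X_tail_9⟩
  · exact ⟨13, by norm_num, cellP24X_poly_10, cellP24X_tail_10⟩
  · exact ⟨22, by norm_num, cellP24X_poly_11, cellP24X_tail_11⟩
  · exact ⟨34, by norm_num, cellP24X_poly_12, cellP24X_tail_12⟩
  · exact ⟨51, by norm_num, cellP24X_poly_13, cellP24X_tail_13⟩
  · exact ⟨74, by norm_num, cellP24X_poly_14, cellP24X_tail_14⟩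
  · exact ⟨103, by norm_num, cellP24X_poly_15, cellP24X_tail_15⟩
  · exact ⟨138, by norm_num, cellP24X_poly_16, cellP24X_tail_16⟩
  · exact ⟨179, by norm_num, cellP24X_poly_17, cellP24X_tail_17⟩
  · exact ⟨226, by norm_num, cellP24X_poly_18, cellP24X_tail_18⟩
  · exact ⟨278, by norm_num, cellP24X_poly_19, cellP24X_tail_19⟩
  · exact ⟨334, by norm_num, cellP24X_poly_20, cellP24X_tail_20⟩
  · exact ⟨393, by norm_num, cellP24X_poly_21, cellP24X_tail_21⟩
  · exact ⟨453, by norm_num, cellP24X_poly_22, cellP24X_tail_22⟩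
  · exact ⟨513, by norm_num, cellP24X_poly_23, cellP24X_tail_23⟩
  · exact ⟨571, by norm_num, cellP24X_poly_24, cellP24X_tail_24⟩
  · exact ⟨627, by norm_num, cellP24X_poly_25, cellP24X_tail_25⟩

end S2

namespace ThmN

open Set

variable {α : Type}

/-- **The `e`-free core at level `5`, rank `22`, corank `8`**: the mid spanning sets number `≤ 91·C(12, 6)`
(S2MidFlatsEight), and the cell `(22, 8)` closes with the mid class explicit. -/
theorem c025_core_five_twentytwo_eight (M : Matroid α) [M.Finite]
    (hR : M.eRank = ((22 : ℕ) : ℕ∞)) (hn : M.E.ncard = 22 + 8)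
    (hfree : ∀ e ∈ M.E, ∃ A ⊆ M.E \ {e}, e ∉ M.closure A ∧ e ∉ M.closure ((M.E \ {e}) \ A)) :
    RLS M 22 5 := by
  have hL0 : ∀ e ∈ M.E, ¬ M.IsLoop e := not_isLoop_of_free M hfree
  have hd : M.E.encard = M.eRank + 8 := by
    rw [hR, ← M.ground_finite.cast_ncard_eq, hn]
    push_cast
    ring
  have hflat' : ∀ X ⊆ M.E, M.eRk X ≤ ((5 - 1 : ℕ) : ℕ∞) → X.ncard ≤ 10 := fun X hX hr =>
    ncard_le_ten_of_eRk_le_four_of_free M hfree hX (by simpa using hr)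
  have hC2 : ∀ P ⊆ M.E, M.eRk P ≤ 3 → P.ncard ≤ 6 :=
    fun P hP hr => ncard_le_six_of_eRk_le_three_of_free M hfree hP hr
  have hC0 : ∀ X ⊆ M.E, M.eRk X ≤ 1 → X.ncard ≤ 1 := fun X hX hr => by
    have := ncard_add_one_le_two_pow_of_eRk_le M hL0 hfree 1 X hX hr
    omega
  have hmid := S2.card_spanMid_le_eight hflat' hC2 hC0 hd
  have hmid' : (S2.spanMid M 5 (min 10 (4 + 8)) ((8 + 6) / 2 + 1)).card ≤ 91 * (12).choose 6 := by
    rw [show min 10 (4 + 8) = 10 by norm_num, show (8 + 6) / 2 + 1 = 8 by norm_num]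
    exact hmid
  have key := c025_core_five_sharp_cell_xmid M 22 8 (91 * (12).choose 6) (by norm_num) hR hn hfree hmid'
  exact key S2.cellP22XM

/-- **The `e`-free core at level `5`, rank `22`, every corank `6 ≤ d ≤ 26`**. -/
theorem c025_core_five_twentytwo (M : Matroid α) [M.Finite] (d : ℕ) (hd6 : 6 ≤ d)
    (hd26 : d ≤ 26) (hR : M.eRank = ((22 : ℕ) : ℕ∞)) (hn : M.E.ncard = 22 + d)
    (hfree : ∀ e ∈ M.E, ∃ A ⊆ M.E \ {e}, e ∉ M.closure A ∧ e ∉ M.closure ((M.E \ {e}) \ A)) :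
    RLS M 22 5 := by
  by_cases h8 : d = 8
  · subst h8
    exact c025_core_five_twentytwo_eight M hR hn hfree
  · exact c025_core_five_sharp_cell_x M 22 d hd6 hR hn hfree (S2.cellsP22X d hd6 hd26 h8)

/-- **The `e`-free core at level `5`, rank `23`, every corank `6 ≤ d ≤ 25`**. -/
theorem c025_core_five_twentythree (M : Matroid α) [M.Finite] (d : ℕ) (hd6 : 6 ≤ d)
    (hd25 : d ≤ 25) (hR : M.eRank = ((23 : ℕ) : ℕ∞)) (hn : M.E.ncard = 23 + d)
    (hfree : ∀ e ∈ M.E, ∃ A ⊆ M.E \ {e}, e ∉ M.closure A ∧ e ∉ M.closure ((M.E \ {e}) \ A)) :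
    RLS M 23 5 :=
  c025_core_five_sharp_cell_x M 23 d hd6 hR hn hfree (S2.cellsP23X d hd6 hd25)

/-- **The `e`-free core at level `5`, rank `24`, every corank `6 ≤ d ≤ 25`** (on T⁺⁺⁺ / T4⁺; no mid treatment). -/
theorem c025_core_five_twentyfour_x (M : Matroid α) [M.Finite] (d : ℕ) (hd6 : 6 ≤ d)
    (hd25 : d ≤ 25) (hR : M.eRank = ((24 : ℕ) : ℕ∞)) (hn : M.E.ncard = 24 + d)
    (hfree : ∀ e ∈ M.E, ∃ A ⊆ M.E \ {e}, e ∉ M.closure A ∧ e ∉ M.closure ((M.E \ {e}) \ A)) :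
    RLS M 24 5 :=
  c025_core_five_sharp_cell_x M 24 d hd6 hR hn hfree (S2.cellsP24X d hd6 hd25)

/-- **THEOREM C₅, GIVEN LEVEL `4` FROM `P ≥ 22`**: level `4` for all `p ≥ P` implies level `5` for all `p ≥ P + 1`. -/
theorem c025_five_of_four_sharp_x_from (P : ℕ) (hP : 22 ≤ P)
    (h4 : ∀ (M : Matroid α) [M.Finite] (p : ℕ), P ≤ p → RLS M p 4) :
    ∀ (M : Matroid α) [M.Finite] (p : ℕ), P + 1 ≤ p → RLS M p 5 := by
  refine S2.rls_five_of_four_of_core P (by omega) h4 ?_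
  intro M _ p hP' hR hbig hfree
  rcases Nat.lt_or_ge p 23 with h22 | h23
  · have hp' : p = 22 := by omega
    subst hp'
    rcases Nat.lt_or_ge M.E.ncard (22 + 27) with h | h
    · exact c025_core_five_twentytwo M (M.E.ncard - 22) (by omega) (by omega) hR (by omega) hfree
    · exact c025_core_five_nineteen_at_twentytwo M (by omega) hfree
  rcases Nat.lt_or_ge p 24 with h23' | h24
  · have hp' : p = 23 := by omega
    subst hp'
    rcases Nat.lt_or_ge M.E.ncard (23 + 26) with h | h
    · exact c025_core_five_twentythree M (M.E.ncard - 23) (by omega) (by omega) hR (by omega) hfree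
    · exact c025_core_five_nineteen_at_twentythree M (by omega) hfree
  rcases Nat.lt_or_ge p 25 with h24' | h25
  · have hp' : p = 24 := by omega
    subst hp'
    rcases Nat.lt_or_ge M.E.ncard (24 + 26) with h | h
    · exact c025_core_five_twentyfour_x M (M.E.ncard - 24) (by omega) (by omega) hR (by omega) hfree
    · exact c025_core_five_nineteen_at_twentyfour M (by omega) hfree
  rcases Nat.lt_or_ge p 26 with h25' | h26
  · have hp' : p = 25 := by omega
    subst hp'
    rcases Nat.lt_or_ge M.E.ncard (25 + 26) with h | h
    · exact c025_core_five_twentyfive_cells M (M.E.ncard - 25) (by omega) (by omega) hR (by omega) hfree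
    · exact c025_core_five_nineteen_at_twentyfive M (by omega) hfree
  rcases Nat.lt_or_ge M.E.ncard (p + 26) with h | h
  · exact c025_core_five_sharp_cells M p (M.E.ncard - p) h26 (by omega) (by omega) hR (by omega) hfree
  · rcases Nat.lt_or_ge p 27 with h27 | h27
    · have hp' : p = 26 := by omega
      subst hp'
      exact c025_core_five_nineteen_at_twentysix M (by omega) hfree
    · exact c025_core_five_nineteen M p h27 hR (by omega) hfree

/-- **THEOREM C₅ AT `23`, UNCONDITIONAL**: every finite matroid satisfies C-025 at level `5` for every `p ≥ 23` (level
`4` from S1's `c025_four_seventeen`). -/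
theorem c025_five_large_sharp23 (M : Matroid α) [M.Finite] (p : ℕ) (hp : 23 ≤ p) : RLS M p 5 :=
  c025_five_of_four_sharp_x_from 22 le_rfl (fun M _ p hp => S1.c025_four_seventeen M p (by omega)) M p hp

/-- The level-`5` statement at `p ≥ 23` in the vocabulary of `C025`. -/
theorem c025_five_large_sharp23' (M : Matroid α) [M.Finite] (p : ℕ) (hp : 23 ≤ p) :
    phiK p 5 * ({A : Set α | A ⊆ M.E ∧ M.eRk A = (p : ℕ∞) ∧ M.eRk (M.E \ A) = (5 : ℕ∞)}.ncard : ℚ) ≤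
      ({A : Set α | A ⊆ M.E ∧ (5 : ℕ∞) < M.eRk A ∧ M.eRk A < (p : ℕ∞)}.ncard : ℚ) :=
  c025_five_large_sharp23 M p hp

end ThmN

end PercRepro
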